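import Literature.NumberTheory.EllipticCurves.ModularSymbolsRationalMinusPeriodsProofs
import Literature.NumberTheory.EllipticCurves.ModularFormsGamma0Genus
import HarnessLib

/-!
# Eichler–Shimura for `X₀(N)` and for rational newforms, unconditionally: discharges of the
# period-lattice named facts (trunk EllArithM, items C9/C17)

`ModularFormsGamma0Genus.genusX0_le_finrank_cuspForm_two` proves, for every `N ≥ 1`, the existence
of `g(X₀(N))` linearly independent weight-`2` cusp forms on `Γ₀(N)` (the free-module structure of
`M(Γ₀(N))` over `ℂ[E₄, E₆]`, Gannon 2014, Thm. 3.4), hence the dimension formula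
`dim_ℂ S₂(Γ₀(N)) = g(X₀(N))` (`finrank_cuspForm_two_eq_genusX0_holds`, Diamond–Shurman Thm. 3.5.1)
and the genus-cum-dimension formula `twelve_mul_finrank_cuspForm_two (Γ₀(N))`
(`twelve_mul_finrank_cuspForm_two_gamma0_holds`). The tree had already reduced the whole
Eichler–Shimura lattice package of `ModularSymbols`, `ModularSymbolsLattice` and
`ModularSymbolsPeriodHomology` to exactly that formula (Manin's presentation of `H₁(X₀(N))` by
M-symbols, `ModularSymbolsManin`; Hecke operators on the period homology and multiplicity one,
`ModularSymbolsPeriodHomology`; Manin–Drinfeld for rational newforms,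
`ModularSymbolsManinDrinfeldProofs`), each reduction ending in a theorem `…_of_genus` whose only
hypothesis is `twelve_mul_finrank_cuspForm_two (Gamma0 N)`. This file applies them; nothing else is
proved here. Discharged (all `N ≥ 1`):

* `periodHomology_eq_span_fin_two_mul_finrank_holds` — the period homology
  `H = {h ↦ ⟨γ, h⟩ : γ ∈ Γ₀(N)} ⊆ S₂(Γ₀(N))^∨` is generated by `2 dim_ℂ S₂(Γ₀(N))` elements
  (`H₁(X₀(N), ℤ) ≅ ℤ^{2g}`; Diamond–Shurman §6.1);
* `periodHomology_eq_span_basis_holds` — `H` is the `ℤ`-span of an `ℝ`-basis of `S₂(Γ₀(N))^∨`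
  (`H₁(X₀(N), ℤ)` is a lattice in `Ω¹(X₀(N))^∨`, the Eichler–Shimura / Abel–Jacobi statement for
  `X₀(N)`; Diamond–Shurman §6.1);
* `periodLattice_eq_closure_pair_holds` — for a rational newform `f`, `Λ_f = ℤω₁ + ℤω₂`
  (Cremona 1997, (2.10.1)–(2.10.2));
* `isZLattice_periodLattice_holds` — `Λ_f` is a `ℤ`-lattice in `ℂ` (Shimura 1971, Thm. 7.14:
  `ℂ/Λ_f` is the elliptic curve `E_f`);
* `IsNewform0.exists_rat_smul_plusPeriod_holds`, `IsNewform0.exists_rat_smul_minusPeriod_holds` —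
  `Ω^±_f ≠ 0` and `re [r]⁺_f ∈ ℚ · Ω⁺_f`, `im [r]⁻_f ∈ ℚ · Ω⁻_f` (Manin 1972, Cor. 3.6 with
  Thm. 1.9).

(`IsNewform0.plusPeriod_pos_holds`, `IsNewform0.minusPeriod_pos_holds`,
`finrank_cuspForm_two_eq_genusX0_holds` and `twelve_mul_finrank_cuspForm_two_gamma0_holds` are in
`ModularFormsGamma0Genus`; `IsNewform0.exists_normalizedPlusSymbol_eq_ratCast_holds` is in
`ModularSymbolsNormalizedSymbolProofs`; `conj_mem_periodLattice_holds` in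
`PAdicLFunctionDistributionProofs`.)

## References

* G. Shimura, *Introduction to the arithmetic theory of automorphic functions* (1971), Thm. 7.14.
* F. Diamond, J. Shurman, *A first course in modular forms*, GTM 228 (2005), Thm. 3.5.1, §6.1.
* J. E. Cremona, *Algorithms for modular elliptic curves*, 2nd ed. (1997), §2.10.
* Ju. I. Manin, *Parabolic points and zeta functions of modular curves* (1972), Thm. 1.9, Cor. 3.6.
* T. Gannon, *The theory of vector-valued modular forms for the modular group* (2014), Thm. 3.4.
-/

noncomputable section

open scoped MatrixGroups ModularForm

open CongruenceSubgroup

namespace Literature.NumberTheory.EllipticCurves.ModularForms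

section PeriodHomology

variable (N : ℕ) [NeZero N]

/-- **`H₁(X₀(N), ℤ) ≅ ℤ^{2g}` with `g = dim_ℂ S₂(Γ₀(N))`**, discharged: the period homology of
`Γ₀(N)` inside `S₂(Γ₀(N))^∨` is generated by `2 dim_ℂ S₂(Γ₀(N))` elements, for every `N ≥ 1`
(Manin's rank bound `dim_ℚ ℚH ≤ 2g(X₀(N))` and `g(X₀(N)) = dim S₂(Γ₀(N))`).
[cite: DiamondShurman2005, §6.1 pp. 217–218] -/
theorem periodHomology_eq_span_fin_two_mul_finrank_holds :
    periodHomology_eq_span_fin_two_mul_finrank N :=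
  periodHomology_eq_span_fin_two_mul_finrank_of_genus N
    (twelve_mul_finrank_cuspForm_two_gamma0_holds N)

/-- **The period homology is a full lattice in `S₂(Γ₀(N))^∨`** (Eichler–Shimura for `X₀(N)`:
`H₁(X₀(N), ℤ)` is the `ℤ`-span of an `ℝ`-basis of `Ω¹_hol(X₀(N))^∨`), discharged for every
`N ≥ 1`. [cite: DiamondShurman2005, §6.1 pp. 217–218] -/
theorem periodHomology_eq_span_basis_holds : periodHomology_eq_span_basis N :=
  periodHomology_eq_span_basis_of_genus N (twelve_mul_finrank_cuspForm_two_gamma0_holds N)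

end PeriodHomology

section Newform

variable {N : ℕ} [NeZero N] {f : CuspForm (Gamma0 N) 2}

/-- **`Λ_f = ℤω₁ + ℤω₂` for a rational newform** (the rank statement of Eichler–Shimura,
Cremona 1997, (2.10.1)–(2.10.2)), discharged for every level. [cite: CremonaAlgorithms1997, §2.10 (2.10.1)–(2.10.2)] -/
theorem periodLattice_eq_closure_pair_holds : periodLattice_eq_closure_pair (f := f) :=
  periodLattice_eq_closure_pair_of_genus (twelve_mul_finrank_cuspForm_two_gamma0_holds N)

/-- **Eichler–Shimura for rational weight-`2` newforms**, discharged: for a normalised newform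
`f ∈ S₂(Γ₀(N))` with rational coefficients the period lattice `Λ_f ⊆ ℂ` is a `ℤ`-lattice
(discrete of rank `2`, spanning `ℂ` over `ℝ`), for every `N ≥ 1` (Shimura 1971, Thm. 7.14).
[cite: Shimura1971, Thm. 7.14] -/
theorem isZLattice_periodLattice_holds : isZLattice_periodLattice (f := f) :=
  isZLattice_periodLattice_of_genus (twelve_mul_finrank_cuspForm_two_gamma0_holds N)

/-- **`Ω⁺_f ≠ 0` and `re [r]⁺_f ∈ ℚ · Ω⁺_f`** for rational newforms (the named fact
`IsNewform0.exists_rat_smul_plusPeriod` of `ModularSymbols`; Manin 1972, Cor. 3.6 with Thm. 1.9),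
discharged for every level by `IsNewform0.exists_rat_smul_plusPeriod_of_genus`
(`ModularSymbolsRationalPeriodsProofs`). [cite: Manin1972, Cor. 3.6 with Thm. 1.9] -/
theorem IsNewform0.exists_rat_smul_plusPeriod_holds :
    IsNewform0.exists_rat_smul_plusPeriod (f := f) :=
  IsNewform0.exists_rat_smul_plusPeriod_of_genus (twelve_mul_finrank_cuspForm_two_gamma0_holds N)

/-- **`Ω⁻_f ≠ 0` and `im [r]⁻_f ∈ ℚ · Ω⁻_f`** for rational newforms (the named fact
`IsNewform0.exists_rat_smul_minusPeriod` of `ModularSymbols`; Manin 1972, Cor. 3.6), discharged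
for every level by `IsNewform0.exists_rat_smul_minusPeriod_of_genus`. [cite: Manin1972, Cor. 3.6] -/
theorem IsNewform0.exists_rat_smul_minusPeriod_holds :
    IsNewform0.exists_rat_smul_minusPeriod (f := f) :=
  IsNewform0.exists_rat_smul_minusPeriod_of_genus (twelve_mul_finrank_cuspForm_two_gamma0_holds N)

end Newform

end Literature.NumberTheory.EllipticCurves.ModularForms
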